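import Summits.QuantumFields.BalabanUV.T4Continuum.Spine.NE5.StepObjectFromActivities
import Summits.QuantumFields.BalabanUV.T4Continuum.Spine.NE5.SeamFromEntrywise

/-!
# Spine/NE5/StepObjectFromEntrywise — the D4 ↔ NE5 junction read with an ENTRYWISE-holomorphic seam
# (cell `pub-balaban-gaps`, YM blitz Y1, track G2, seat `ne5` gen 3; follower of `StepObjectFromActivities` p343082 and `SeamFromEntrywise`)

* §1 `differentiableOn_H_at_of_hH_entrywise` — `StepObjectFromActivities.differentiableOn_H_at_of_hH` with the seam hypothesis `hs` REPLACED by print's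
  ENTRYWISE currency (`SeamFromEntrywise.differentiableOn_seam_of_entrywise`, i.e. Mujica 1986 Ex. 8.H via `Literature/Analysis/Complex/HolomorphicIntoLinfty`):
  NE5's H-layer datum `hH` at an admissible base point + a seam whose operator ENTRIES and history ENTRIES are ℂ-differentiable on [I]'s (4.4)-ball with
  entrywise-uniform bounds and whose data image stays in the admissible box ⟹ row D4's activity-holomorphy leaf for `stepObjectOfActivitiesAt`.
(The Z-LOCAL object answering an4's remark R1 is the sibling leaf `Spine/NE5/StepObjectLocal`.)

HONEST FRAMING.  Bookkeeping by composition; `act`, `dat`, the seam and every bound are HYPOTHESES; nothing of Bałaban's is constructed or asserted;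
NE5 NOT PRINTED ∕ NOT PROVED, (D4) NOT discharged, NODE O instance 0∕1; 0∕12 NE5 leaves on Bałaban's objects.  Rung (B)+1 on a FIXED finite T⁴ — NOT
continuum by itself, NOT infinite volume, NOT mass gap, NOT Clay.  Spine PROVED 0∕9.  HONEST DEPENDENCY: continuum YM on T⁴ ⇐ BetaPertH ∧ nine spine
estimates; BetaPertH ⇐ (D1) ∧ (D4) ∧ CAP+tail.  0 sorry, 0 def.
-/

noncomputable section

namespace Summit.QuantumFields.BalabanUV.T4Continuum.Spine.NE5

open Set Metric
open scoped ENNReal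
open Literature.MathematicalPhysics.QuantumFieldTheory.Balaban1983to89
open Literature.MathematicalPhysics.QuantumFieldTheory.Balaban1983to89.T4InputCauchyRateData
open Literature.MathematicalPhysics.QuantumFieldTheory.Balaban1983to89.TreeLengthTorus (TPt TDom tsys torusTreeLen)
open Summit.QuantumFields.BalabanUV.T4Continuum.B13Carriers (TwoRuns)

/-! ## §1 The junction with ENTRYWISE seam data: NE5's `hH` + entrywise-holomorphic seam ⟹ row D4's activity-holomorphy leaf -/

section RecordEntrywise

variable {G : Type} [GaugeGroup G] (R : TwoRuns G)
variable {E₁ : Type*} {E₂ : Type*} [TopologicalSpace E₂] [DiscreteTopology E₂]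

variable (M : StepModel R.carriers (lp (fun _ : E₁ => ℂ) ∞) (BoundedContinuousFunction E₂ ℂ))
variable {act : (j : ℕ) → (lp (fun _ : E₁ => ℂ) ∞) × BoundedContinuousFunction E₂ ℂ → TDom 4 (R.cubesPerDir j) → ℂ}
  {W : Set (ℕ → ℝ)} {A Rd : ℝ}
variable {Wn : Type*} [NormedAddCommGroup Wn] [NormedSpace ℂ Wn]

/-- **ROW D4's ACTIVITY-HOLOMORPHY LEAF FROM NE5's `hH` AND AN ENTRYWISE-HOLOMORPHIC SEAM** (data spaces of the record kind `OpDatum E₁ × (E₂ →ᵇ ℂ)`):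
NE5's H-layer datum at an admissible base point `p ∈ M.Base j g U`, a seam whose operator entries and history entries are complex-differentiable on
the α₂-ball with entrywise-uniform bounds (print's currency, [B9] Thm 3.4) and whose data image stays in the admissible box of `p`, give
`DifferentiableOn ℂ (v ↦ H Z (s v)) (ball 0 α₂)` for `stepObjectOfActivitiesAt R M j p Φ dat (act j)` —
`StepObjectFromActivities.differentiableOn_H_at_of_hH` ∘ `SeamFromEntrywise.differentiableOn_seam_of_entrywise`. [cite: Mujica1986, Ex. 8.H] -/
theorem differentiableOn_H_at_of_hH_entrywise
    (hH : ∀ j, ∀ g ∈ W, ∀ (U : R.carriers.BgB) (p : lp (fun _ : E₁ => ℂ) ∞ × BoundedContinuousFunction E₂ ℂ), p ∈ M.Base j g U →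
      ∃ V : Set (lp (fun _ : E₁ => ℂ) ∞ × BoundedContinuousFunction E₂ ℂ), IsOpen V ∧ M.box j p ⊆ V ∧
        (∀ Z : TDom 4 (R.cubesPerDir j), DifferentiableOn ℂ (fun z : lp (fun _ : E₁ => ℂ) ∞ × BoundedContinuousFunction E₂ ℂ => act j z Z) V) ∧
        (∀ z ∈ V, ∀ Z : TDom 4 (R.cubesPerDir j), ‖act j z Z‖ ≤ A * Real.exp (-(Rd * torusTreeLen Z.1))))
    {j : ℕ} {g : ℕ → ℝ} (hg : g ∈ W) {U : R.carriers.BgB} {p : lp (fun _ : E₁ => ℂ) ∞ × BoundedContinuousFunction E₂ ℂ} (hp : p ∈ M.Base j g U)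
    (Φ : Type) (dat : Φ → lp (fun _ : E₁ => ℂ) ∞ × BoundedContinuousFunction E₂ ℂ) {s : Wn → Φ} {α₂ B₁ B₂ : ℝ}
    (hop : ∀ e, DifferentiableOn ℂ (fun v => (dat (s v)).1 e) (ball 0 α₂))
    (hB₁ : 0 ≤ B₁) (hopB : ∀ v ∈ ball (0 : Wn) α₂, ∀ e, ‖(dat (s v)).1 e‖ ≤ B₁)
    (hhist : ∀ a, DifferentiableOn ℂ (fun v => (dat (s v)).2 a) (ball 0 α₂))
    (hB₂ : 0 ≤ B₂) (hhistB : ∀ v ∈ ball (0 : Wn) α₂, ∀ a, ‖(dat (s v)).2 a‖ ≤ B₂)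
    (hmaps : MapsTo (fun v => dat (s v)) (ball 0 α₂) (M.box j p)) (Z : TDom 4 (R.cubesPerDir j)) :
    DifferentiableOn ℂ (fun v => (stepObjectOfActivitiesAt R M j p Φ dat (act j)).H Z (s v)) (ball 0 α₂) :=
  differentiableOn_H_at_of_hH R M hH hg hp Φ dat (differentiableOn_seam_of_entrywise hop hB₁ hopB hhist hB₂ hhistB) hmaps Z

end RecordEntrywise

end Summit.QuantumFields.BalabanUV.T4Continuum.Spine.NE5
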